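import Summits.Parity.GeneralizedHardyLittlewood.Theses.LeeYangFibres
import Literature.NumberTheory.Sieve.LinearEquationsInPrimesSingularSeries
import Literature.NumberTheory.Sieve.ClusterComplexity
import Literature.NumberTheory.Sieve.SingularSeriesProofs
import HarnessLib

/-!
# Route `LeeYangFibres`, item `AbsoluteUpgrade` (stmt-Parity-14116): the high-singular-mass
# regime is inhabited at `t = 2`

The residual core of `AbsoluteUpgrade := RelativeDimOne → DimOne` consists of the admissible pairs
`(Ψ, K)` (`d = 1`, `t ≥ 2`, `‖Ψ‖_N ≤ L`, `K ⊆ [-N, N]` convex) whose singular mass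
`archFactor Ψ K * singularProduct Ψ = β_∞ ∏_p β_p` exceeds `M N`: on pairs of mass `≤ M N` the
relative error `ε (β_∞ ∏_p β_p + N)` of `RelativeDimOne` is already absolute.  This file proves
that the core is NOT empty, for every threshold `M`, already at `t = 2`, `L = 3` and at
arbitrarily large scales `N`: for the shift pair `Ψ_h = (n, n + h)`
(`Literature.NumberTheory.Sieve.shiftPairSystem`) with `h = w#` a primorial and `K = [-N, N]`,
`N ≥ h`,

* `β_p(Ψ_h) ≥ 1 + 1/p` for the primes `p ≤ w` (they divide `h`: one excluded residue), and
  `β_p(Ψ_h) ≥ 1 - 1/(p-1)²` for every prime (at most two excluded residues)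
  (`localFactor_shiftPair_ge_of_dvd`, `localFactor_shiftPair_ge`);
* hence `∏_{p ≤ x} β_p ≥ (∑_{p ≤ w} 1/p) · ∏_{2 < p ≤ x} (1 - 1/(p-1)²) ≥ ½ ∑_{p ≤ w} 1/p` for
  `x ≥ w` (`singularProductPartial_shiftPair_ge`), and in the limit (Green–Tao Lemma 1.3, tree)
  `∏_p β_p(Ψ_h) ≥ ½ ∑_{p ≤ w} 1/p` (`singularProduct_shiftPair_ge`), which is unbounded in `w`
  (divergence of `∑ 1/p`, Mathlib);
* `β_∞(Ψ_h, [-N, N]) ≥ N` (`archFactor_shiftPair_ge`) and `‖Ψ_h‖_N = 2 + h/N ≤ 3`;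
* `exists_highMass_pair`: for every `M` and `N₀` there are `N ≥ N₀` and an admissible pair at
  `t = 2`, `L = 3` with `archFactor Ψ K * singularProduct Ψ ≥ M N`.

So no uniform bound `β_∞ ∏_p β_p ≤ C(t, L) N` exists for `t ≥ 2` (in contrast with `t = 1`), and
the bounded-mass slice of the upgrade cannot exhaust `DimOne`: the threshold regime isolated in
`Theorems/LeeYangFibresAbsoluteUpgradeSlices` carries genuine content (prime pairs at primorial
shifts, `∏_p β_p ≍ log log N`).
-/

noncomputable section

namespace Summit.Parity.GeneralizedHardyLittlewood.Theorems.AbsoluteUpgrade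

open MeasureTheory Finset Filter Literature.NumberTheory.Sieve
open scoped Topology

/-! ### The shift pair modulo `p` -/

/-- The first form of the shift pair reduces to `v ↦ v₀` modulo `p`. -/
theorem modEval_shiftPair_zero (h : ℤ) (p : ℕ) (v : Fin 1 → ZMod p) :
    (shiftPairSystem h 0).modEval p v = v 0 := by
  simp [shiftPairSystem, AffLinForm.modEval]

/-- The second form of the shift pair reduces to `v ↦ v₀ + h` modulo `p`. -/
theorem modEval_shiftPair_one (h : ℤ) (p : ℕ) (v : Fin 1 → ZMod p) :
    (shiftPairSystem h 1).modEval p v = v 0 + (h : ZMod p) := by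
  simp [shiftPairSystem, AffLinForm.modEval]

/-- In dimension one, exactly one residue vector has `v₀ + c = 0`. -/
theorem card_filter_add_eq_zero {p : ℕ} [NeZero p] (c : ZMod p) :
    #({v : Fin 1 → ZMod p | v 0 + c = 0} : Finset _) = 1 := by
  refine Finset.card_eq_one.mpr ⟨fun _ => -c, ?_⟩
  ext v
  simp only [Finset.mem_filter, Finset.mem_univ, true_and, Finset.mem_singleton,
    add_eq_zero_iff_eq_neg]
  constructor
  · intro hv
    funext j
    rw [Subsingleton.elim j 0, hv]
  · intro hv
    rw [hv]

/-- The residues excluded by the shift pair: `v₀ = 0` or `v₀ + h = 0`; at most two of them. -/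
theorem card_bad_shiftPair_le_two {p : ℕ} [NeZero p] (c : ZMod p) :
    #({v : Fin 1 → ZMod p | v 0 = 0 ∨ v 0 + c = 0} : Finset _) ≤ 2 := by
  rw [Finset.filter_or]
  refine (Finset.card_union_le _ _).trans ?_
  have h1 : #({v : Fin 1 → ZMod p | v 0 = 0} : Finset _) = 1 := by
    simpa using card_filter_add_eq_zero (p := p) 0
  rw [h1, card_filter_add_eq_zero c]

/-- If `p ∣ h` the two exclusions coincide: exactly one excluded residue. -/
theorem card_bad_shiftPair_eq_one {p : ℕ} [NeZero p] {c : ZMod p} (hc : c = 0) :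
    #({v : Fin 1 → ZMod p | v 0 = 0 ∨ v 0 + c = 0} : Finset _) = 1 := by
  subst hc
  simpa using card_filter_add_eq_zero (p := p) 0

/-- `goodCount + #(excluded residues) = p` for the shift pair. -/
theorem goodCount_shiftPair_add {p : ℕ} [Fact p.Prime] (h : ℤ) :
    goodCount (shiftPairSystem h) p +
      #({v : Fin 1 → ZMod p | v 0 = 0 ∨ v 0 + (h : ZMod p) = 0} : Finset _) = p := by
  have hgood : goodCount (shiftPairSystem h) p =
      #(Finset.univ.filter fun v : Fin 1 → ZMod p => ¬ (v 0 = 0 ∨ v 0 + (h : ZMod p) = 0)) := by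
    unfold goodCount
    refine congr_arg Finset.card (Finset.filter_congr fun v _ => ?_)
    rw [Fin.forall_fin_two, modEval_shiftPair_zero, modEval_shiftPair_one, not_or]
  rw [hgood, add_comm, Finset.card_filter_add_card_filter_not, Finset.card_univ,
    card_zmod_pow, pow_one]

/-! ### Lower bounds for the local factors of the shift pair -/

/-- Every local factor of the shift pair satisfies `β_p ≥ 1 - 1/(p-1)²` (at most two excluded
residues: `β_p ≥ p⁻¹ (p/(p-1))² (p - 2)`). -/
theorem localFactor_shiftPair_ge {p : ℕ} (hp : p.Prime) (h : ℤ) :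
    1 - 1 / ((p : ℝ) - 1) ^ 2 ≤ localFactor (shiftPairSystem h) p := by
  haveI := Fact.mk hp
  have hp2 : (2 : ℝ) ≤ p := by exact_mod_cast hp.two_le
  have hp1 : (0 : ℝ) < (p : ℝ) - 1 := by linarith
  have hp0 : (0 : ℝ) < p := by linarith
  have hgc : (p : ℝ) - 2 ≤ (goodCount (shiftPairSystem h) p : ℝ) := by
    have h1 := goodCount_shiftPair_add (p := p) h
    have h2 := card_bad_shiftPair_le_two (p := p) (h : ZMod p)
    have : p ≤ goodCount (shiftPairSystem h) p + 2 := by omega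
    have : (p : ℝ) ≤ (goodCount (shiftPairSystem h) p : ℝ) + 2 := by exact_mod_cast this
    linarith
  rw [localFactor_prime, pow_one]
  calc 1 - 1 / ((p : ℝ) - 1) ^ 2 = (p : ℝ)⁻¹ * (((p : ℝ) / (p - 1)) ^ 2 * ((p : ℝ) - 2)) := by
        field_simp
        ring
    _ ≤ (p : ℝ)⁻¹ * (((p : ℝ) / (p - 1)) ^ 2 * (goodCount (shiftPairSystem h) p : ℝ)) := by
        gcongr

/-- For the primes dividing the shift, `β_p ≥ 1 + 1/p` (one excluded residue:
`β_p = p⁻¹ (p/(p-1))² (p - 1) = p/(p-1)`). -/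
theorem localFactor_shiftPair_ge_of_dvd {p : ℕ} (hp : p.Prime) {h : ℤ} (hdvd : (p : ℤ) ∣ h) :
    1 + 1 / (p : ℝ) ≤ localFactor (shiftPairSystem h) p := by
  haveI := Fact.mk hp
  have hp2 : (2 : ℝ) ≤ p := by exact_mod_cast hp.two_le
  have hp1 : (0 : ℝ) < (p : ℝ) - 1 := by linarith
  have hp0 : (0 : ℝ) < p := by linarith
  have hc : ((h : ℤ) : ZMod p) = 0 := by
    rwa [ZMod.intCast_zmod_eq_zero_iff_dvd]
  have hgc : (goodCount (shiftPairSystem h) p : ℝ) = (p : ℝ) - 1 := by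
    have h1 := goodCount_shiftPair_add (p := p) h
    rw [card_bad_shiftPair_eq_one hc] at h1
    have : ((goodCount (shiftPairSystem h) p + 1 : ℕ) : ℝ) = p := by exact_mod_cast h1
    push_cast at this
    linarith
  rw [localFactor_prime, pow_one, hgc]
  calc 1 + 1 / (p : ℝ) ≤ 1 + 1 / ((p : ℝ) - 1) := by
        gcongr
        linarith
    _ = (p : ℝ)⁻¹ * (((p : ℝ) / (p - 1)) ^ 2 * ((p : ℝ) - 1)) := by
        field_simp
        ring

/-! ### Lower bound for the singular product of `(n, n + w#)` -/

/-- `1 + ∑ aᵢ ≤ ∏ (1 + aᵢ)` for non-negative reals. -/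
theorem one_add_sum_le_prod_one_add {ι : Type*} (s : Finset ι) (f : ι → ℝ)
    (hf : ∀ i ∈ s, 0 ≤ f i) : 1 + ∑ i ∈ s, f i ≤ ∏ i ∈ s, (1 + f i) := by
  classical
  induction s using Finset.induction_on with
  | empty => simp
  | insert a s ha ih =>
    rw [Finset.sum_insert ha, Finset.prod_insert ha]
    have ha0 : 0 ≤ f a := hf a (Finset.mem_insert_self a s)
    have hs : ∀ i ∈ s, 0 ≤ f i := fun i hi => hf i (Finset.mem_insert_of_mem hi)
    have ih' := ih hs
    have hsum : 0 ≤ ∑ i ∈ s, f i := Finset.sum_nonneg hs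
    nlinarith

/-- For `x ≥ w ≥ 2`: `∏_{p ≤ x} β_p(n, n + w#) ≥ ½ ∑_{p ≤ w} 1/p`.  The primes `p ≤ w` divide `w#`
and contribute `∏ (1 + 1/p) ≥ ∑ 1/p`; the primes `w < p ≤ x` contribute at least
`∏_{2 < p ≤ x} (1 - 1/(p-1)²) ≥ ½` (`half_le_twinPrimeConstPartial`). -/
theorem singularProductPartial_shiftPair_ge {w x : ℕ} (hw : 2 ≤ w) (hwx : w ≤ x) :
    (1 / 2) * ∑ p ∈ Nat.primesLE w, 1 / (p : ℝ) ≤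
      singularProductPartial (shiftPairSystem (primorial w : ℤ)) x := by
  set Ψ := shiftPairSystem (primorial w : ℤ) with hΨ
  unfold singularProductPartial
  rw [← Finset.prod_filter_mul_prod_filter_not (Nat.primesLE x) (fun p => p ≤ w)]
  -- the small primes
  have hA : (Nat.primesLE x).filter (fun p => p ≤ w) = Nat.primesLE w := by
    ext p
    simp only [Finset.mem_filter, Nat.mem_primesLE]
    constructor
    · rintro ⟨⟨-, hp⟩, hpw⟩
      exact ⟨hpw, hp⟩
    · rintro ⟨hpw, hp⟩
      exact ⟨⟨hpw.trans hwx, hp⟩, hpw⟩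
  have hsmall : ∑ p ∈ Nat.primesLE w, 1 / (p : ℝ) ≤
      ∏ p ∈ (Nat.primesLE x).filter (fun p => p ≤ w), localFactor Ψ p := by
    rw [hA]
    calc ∑ p ∈ Nat.primesLE w, 1 / (p : ℝ) ≤ 1 + ∑ p ∈ Nat.primesLE w, 1 / (p : ℝ) := by
          linarith
      _ ≤ ∏ p ∈ Nat.primesLE w, (1 + 1 / (p : ℝ)) :=
          one_add_sum_le_prod_one_add _ _ fun p _ => by positivity
      _ ≤ ∏ p ∈ Nat.primesLE w, localFactor Ψ p := by
          refine Finset.prod_le_prod (fun p _ => by positivity) fun p hp => ?_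
          obtain ⟨hpw, hpp⟩ := Nat.mem_primesLE.mp hp
          exact localFactor_shiftPair_ge_of_dvd hpp
            (Int.natCast_dvd_natCast.mpr ((Nat.Prime.dvd_primorial_iff hpp).mpr hpw))
  -- the large primes
  have hsub : (Nat.primesLE x).filter (fun p => ¬ p ≤ w) ⊆ (Nat.primesLE x).filter (2 < ·) := by
    intro p hp
    obtain ⟨hp1, hp2⟩ := Finset.mem_filter.mp hp
    exact Finset.mem_filter.mpr ⟨hp1, by omega⟩
  have hlarge : 1 / 2 ≤ ∏ p ∈ (Nat.primesLE x).filter (fun p => ¬ p ≤ w), localFactor Ψ p := by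
    calc (1 : ℝ) / 2 ≤ twinPrimeConstPartial x := half_le_twinPrimeConstPartial x
      _ ≤ ∏ p ∈ (Nat.primesLE x).filter (fun p => ¬ p ≤ w), (1 - 1 / ((p : ℝ) - 1) ^ 2) := by
          unfold twinPrimeConstPartial
          rw [← Finset.prod_sdiff hsub]
          refine mul_le_of_le_one_left ?_ ?_
          · refine Finset.prod_nonneg fun p hp => ?_
            obtain ⟨-, hp2⟩ := Finset.mem_filter.mp hp
            exact twinPrimeConstFactor_nonneg (by omega)
          · refine Finset.prod_le_one (fun p hp => ?_) (fun p _ => twinPrimeConstFactor_le_one p)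
            obtain ⟨hp1, -⟩ := Finset.mem_sdiff.mp hp
            obtain ⟨-, hp2⟩ := Finset.mem_filter.mp hp1
            exact twinPrimeConstFactor_nonneg (by omega)
      _ ≤ ∏ p ∈ (Nat.primesLE x).filter (fun p => ¬ p ≤ w), localFactor Ψ p := by
          refine Finset.prod_le_prod (fun p hp => ?_) fun p hp => ?_
          · obtain ⟨-, hp2⟩ := Finset.mem_filter.mp hp
            exact twinPrimeConstFactor_nonneg (by omega)
          · obtain ⟨hp1, -⟩ := Finset.mem_filter.mp hp
            exact localFactor_shiftPair_ge (Nat.mem_primesLE.mp hp1).2 _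
  calc (1 / 2) * ∑ p ∈ Nat.primesLE w, 1 / (p : ℝ)
      = (∑ p ∈ Nat.primesLE w, 1 / (p : ℝ)) * (1 / 2) := by ring
    _ ≤ (∏ p ∈ (Nat.primesLE x).filter (fun p => p ≤ w), localFactor Ψ p) *
          ∏ p ∈ (Nat.primesLE x).filter (fun p => ¬ p ≤ w), localFactor Ψ p :=
        mul_le_mul hsmall hlarge (by norm_num)
          (Finset.prod_nonneg fun p _ => localFactor_nonneg Ψ p)

/-- The shift pair `(n, n + h)`, `h ≠ 0`, satisfies Green–Tao's standing hypotheses. -/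
theorem isNondegenerateSystem_shiftPair {h : ℤ} (hh : h ≠ 0) :
    IsNondegenerateSystem (shiftPairSystem h) := by
  refine ⟨fun i => ?_, fun i j hij a b hab => ?_⟩
  · fin_cases i <;> simp [shiftPairSystem]
  · have h0 := hab 0
    have h1 := hab 1
    simp only [shiftPairSystem, AffLinForm.eval, Fin.sum_univ_one, Pi.zero_apply, mul_zero,
      Pi.one_apply, mul_one] at h0 h1
    fin_cases i <;> fin_cases j
    · exact absurd rfl hij
    · simp only [Fin.zero_eta, Fin.mk_one, Matrix.cons_val_zero, Matrix.cons_val_one,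
        Matrix.cons_val_fin_one] at h0 h1
      have hb : b = 0 := by
        have : b * h = 0 := by linarith
        rcases mul_eq_zero.mp this with hb | hh' <;> [exact hb; exact absurd hh' hh]
      subst hb
      constructor <;> linarith
    · simp only [Fin.zero_eta, Fin.mk_one, Matrix.cons_val_zero, Matrix.cons_val_one,
        Matrix.cons_val_fin_one] at h0 h1
      have ha : a = 0 := by
        have : a * h = 0 := by linarith
        rcases mul_eq_zero.mp this with ha | hh' <;> [exact ha; exact absurd hh' hh]
      subst ha
      constructor <;> linarith
    · exact absurd rfl hij

/-- `∏_p β_p(n, n + w#) ≥ ½ ∑_{p ≤ w} 1/p` (`w ≥ 2`), by Green–Tao's Lemma 1.3 (convergence of the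
ordered partial products, `tendsto_singularProductPartial_holds`). -/
theorem singularProduct_shiftPair_ge {w : ℕ} (hw : 2 ≤ w) :
    (1 / 2) * ∑ p ∈ Nat.primesLE w, 1 / (p : ℝ) ≤
      singularProduct (shiftPairSystem (primorial w : ℤ)) := by
  have hh : (primorial w : ℤ) ≠ 0 := by exact_mod_cast primorial_ne_zero w
  have hT := tendsto_singularProductPartial_holds 1 2 _ (isNondegenerateSystem_shiftPair hh)
  exact ge_of_tendsto hT (eventually_atTop.2 ⟨w, fun x hx =>
    singularProductPartial_shiftPair_ge hw hx⟩)

/-- The sums `∑_{p ≤ w} 1/p` are unbounded (Mathlib: `∑ 1/p` diverges). -/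
theorem exists_sum_primesLE_inv_ge (M : ℝ) : ∃ w : ℕ, 2 ≤ w ∧ M ≤ ∑ p ∈ Nat.primesLE w, 1 / (p : ℝ) := by
  have hdiv := (not_summable_iff_tendsto_nat_atTop_of_nonneg (f := Set.indicator {p | p.Prime}
    (fun n : ℕ => (1 : ℝ) / n)) (fun n => Set.indicator_nonneg (fun _ _ => by positivity) n)).mp
    not_summable_one_div_on_primes
  obtain ⟨n₀, hn₀⟩ := Filter.tendsto_atTop_atTop.mp hdiv M
  refine ⟨max n₀ 2, le_max_right _ _, ?_⟩
  have key : ∀ n : ℕ, ∑ i ∈ Finset.range (n + 1), Set.indicator {p | p.Prime}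
      (fun n : ℕ => (1 : ℝ) / n) i = ∑ p ∈ Nat.primesLE n, 1 / (p : ℝ) := by
    intro n
    simp only [Set.indicator_apply, Set.mem_setOf_eq]
    rw [← Finset.sum_filter]
    rfl
  calc M ≤ ∑ i ∈ Finset.range (max n₀ 2 + 1), Set.indicator {p | p.Prime}
        (fun n : ℕ => (1 : ℝ) / n) i := hn₀ _ (by omega)
    _ = ∑ p ∈ Nat.primesLE (max n₀ 2), 1 / (p : ℝ) := key _

/-! ### The archimedean factor and the size of the shift pair -/

/-- `‖(n, n + h)‖_N = 2 + h/N ≤ 3` for `0 ≤ h ≤ N`. -/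
theorem affLinSize_shiftPair_le {h : ℤ} {N : ℕ} (h0 : 0 ≤ h) (hN : h ≤ N) (hN0 : 0 < N) :
    affLinSize (shiftPairSystem h) N ≤ 3 := by
  have hN' : (0 : ℝ) < N := by exact_mod_cast hN0
  have hhN : (h : ℝ) ≤ N := by exact_mod_cast hN
  have hh0 : (0 : ℝ) ≤ h := by exact_mod_cast h0
  have hq : |(h : ℝ) / N| ≤ 1 := by
    rw [abs_of_nonneg (by positivity), div_le_one hN']
    exact hhN
  have hsize : affLinSize (shiftPairSystem h) N = 2 + |(h : ℝ) / N| := by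
    simp [affLinSize, shiftPairSystem, Fin.sum_univ_two]
    norm_num
  rw [hsize]
  linarith

/-- `β_∞((n, n + h), [-N, N]) ≥ N` for `h ≥ 0`: the body contains `(0, N]`, on which both forms are
positive. -/
theorem archFactor_shiftPair_ge {h : ℤ} (h0 : 0 ≤ h) (N : ℕ) :
    (N : ℝ) ≤ archFactor (shiftPairSystem h) (realBox 1 N) := by
  have hN : (0 : ℝ) ≤ N := Nat.cast_nonneg N
  have hh0 : (0 : ℝ) ≤ h := by exact_mod_cast h0
  -- the witness box `(0, N]`
  have hsub : Set.pi Set.univ (fun _ : Fin 1 => Set.Ioc (0 : ℝ) N) ⊆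
      realBox 1 (N : ℝ) ∩ {x | ∀ i, 0 < (shiftPairSystem h i).realEval x} := by
    intro x hx
    have hx0 : 0 < x 0 ∧ x 0 ≤ N := by simpa using hx 0 (Set.mem_univ _)
    refine ⟨⟨fun j => ?_, fun j => ?_⟩, fun i => ?_⟩
    · rw [Subsingleton.elim j 0]; simp only; linarith [hx0.1]
    · rw [Subsingleton.elim j 0]; exact hx0.2
    · fin_cases i <;> simp [shiftPairSystem, AffLinForm.realEval] <;> linarith [hx0.1]
  have hvolw : (volume (Set.pi Set.univ (fun _ : Fin 1 => Set.Ioc (0 : ℝ) N))).toReal = N := by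
    rw [Real.volume_pi_Ioc_toReal (fun _ => hN)]
    simp
  have htopK : volume (realBox 1 (N : ℝ)) ≠ ⊤ := by
    unfold realBox
    rw [Real.volume_Icc_pi]
    exact ENNReal.prod_ne_top fun _ _ => ENNReal.ofReal_ne_top
  have htop : volume (realBox 1 (N : ℝ) ∩ {x | ∀ i, 0 < (shiftPairSystem h i).realEval x}) ≠ ⊤ :=
    ne_top_of_le_ne_top htopK (measure_mono Set.inter_subset_left)
  calc (N : ℝ) = (volume (Set.pi Set.univ (fun _ : Fin 1 => Set.Ioc (0 : ℝ) N))).toReal :=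
        hvolw.symm
    _ ≤ archFactor (shiftPairSystem h) (realBox 1 N) := by
        unfold archFactor
        exact ENNReal.toReal_mono htop (measure_mono hsub)

/-! ### The high-mass regime is inhabited -/

/-- **The high-singular-mass regime of `AbsoluteUpgrade` is inhabited at `t = 2`, `L = 3`.** For
every threshold `M` and every `N₀` there are `N ≥ N₀`, a system of two forms satisfying Green–Tao's
standing hypotheses with `‖Ψ‖_N ≤ 3` (namely `(n, n + w#)`, `w#` a primorial `≤ N`) and a convex
body `K ⊆ [-N, N]` (namely `[-N, N]`) of singular mass `archFactor Ψ K * singularProduct Ψ ≥ M N`.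
In particular `sup_Ψ ∏_p β_p = ∞` over admissible pairs at fixed `(t, L) = (2, 3)`, so the
relative error of `RelativeDimOne` is not uniformly comparable with the absolute error of
`DimOne`. -/
theorem exists_highMass_pair (M : ℝ) (N₀ : ℕ) : ∃ N : ℕ, N₀ ≤ N ∧
    ∃ Ψ : Fin 2 → AffLinForm 1, IsNondegenerateSystem Ψ ∧ affLinSize Ψ N ≤ 3 ∧
      ∃ K : Set (Fin 1 → ℝ), Convex ℝ K ∧ K ⊆ realBox 1 N ∧
        M * N ≤ archFactor Ψ K * singularProduct Ψ := by
  obtain ⟨w, hw2, hw⟩ := exists_sum_primesLE_inv_ge (2 * max M 0)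
  set h : ℕ := primorial w with hh
  have hhpos : 0 < h := primorial_pos w
  refine ⟨max N₀ h, le_max_left _ _, shiftPairSystem (h : ℤ),
    isNondegenerateSystem_shiftPair (by exact_mod_cast hhpos.ne'), ?_, realBox 1 _,
    convex_Icc _ _, subset_rfl, ?_⟩
  · exact affLinSize_shiftPair_le (by positivity) (by exact_mod_cast le_max_right N₀ h)
      (lt_of_lt_of_le hhpos (le_max_right _ _))
  · have hS : max M 0 ≤ singularProduct (shiftPairSystem (h : ℤ)) := by
      have := singularProduct_shiftPair_ge hw2
      rw [← hh] at this
      linarith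
    have hA := archFactor_shiftPair_ge (h := (h : ℤ)) (by positivity) (max N₀ h)
    calc M * (max N₀ h : ℕ) ≤ max M 0 * (max N₀ h : ℕ) := by
          gcongr
          exact le_max_left _ _
      _ = (max N₀ h : ℕ) * max M 0 := mul_comm _ _
      _ ≤ archFactor (shiftPairSystem (h : ℤ)) (realBox 1 (max N₀ h : ℕ)) *
            singularProduct (shiftPairSystem (h : ℤ)) :=
          mul_le_mul hA hS (le_max_right _ _) ((Nat.cast_nonneg _).trans hA)

end Summit.Parity.GeneralizedHardyLittlewood.Theorems.AbsoluteUpgrade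

end
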